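import Summits.QuantumFields.YangMills.Theorems.SmallFieldWideningLargeFieldMassRefinementTailOfFirstExit
import Summits.QuantumFields.YangMills.Theorems.FirstExitWindowOneStepWindowL

/-!
# Route `SmallFieldWidening` — crux r3 `LargeFieldMassRefinementTail` (stmt-QuantumFields-22884) FROM THE FIRST-EXIT WINDOW TAIL ALONE
# (support file; width seat `ym-line-sfw-p2-w2` gen 16, line `birth` of lead `ym-line-sfw-p2`)

With the window `OneStepWindowL` (stmt-QuantumFields-26244) PROVED (`firstExitWindow_oneStepWindowL_proof`, deterministic one-step smallness propagation)
the two-hypothesis certificate `LargeFieldMassRefinementTailOfFirstExit.largeFieldMassRefinementTail_of_firstExit` loses one hypothesis: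
`FirstExitWindowTailL → LargeFieldMassRefinementTail` — r3 is downstream of the ONE open crux `FirstExitWindowTailL` (stmt-QuantumFields-26243) of route
`FirstExitWindow` (the windowed first-exit tail «small history ∧ level-`j` field in the `b₂`-window ∧ one plaquette `≥ θ_{b₀}(K−j)`», per its thesis the
small-field half of Bałaban's programme), a feeder disjoint from the (α)-record chain `AveragedTailAt` / `IntCoreRec` / `AlphaInputsT3ACv3RecChi`.

WHAT THIS IS NOT: `FirstExitWindowTailL` is open — this is a conditional certificate, no large-field estimate is proved; rung R3 (`YM3TorusSU2`) is a RECORD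
rung, not the Clay statement, and nothing here bears on the Yang–Mills mass gap.

References: T. Bałaban, CMP 102 (1985) 255–275 [Balaban1985UV3] ((7) p.257, (71) p.273); CMP 98 (1985) 17–51 [Balaban1985Averaging] (Prop. 1 (51) p.26).
-/

namespace Summit.QuantumFields.YangMills.Theorems.LargeFieldMassRefinementTailOfFirstExit

/-- **r3 ⇐ THE FIRST-EXIT WINDOW TAIL ALONE**: `FirstExitWindowTailL → LargeFieldMassRefinementTail` (the window `OneStepWindowL` is the theorem
`firstExitWindow_oneStepWindowL_proof`).  Conditional certificate for stmt-QuantumFields-22884 on stmt-QuantumFields-26243; nothing about the mass gap.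
[cite: Balaban1985UV3, (7) p.257 and (71) p.273] -/
theorem largeFieldMassRefinementTail_of_firstExitWindowTailL
    (hF : Summit.QuantumFields.YangMills.Theses.FirstExitWindow.FirstExitWindowTailL) :
    Summit.QuantumFields.YangMills.Theses.SmallFieldWidening.LargeFieldMassRefinementTail :=
  largeFieldMassRefinementTail_of_firstExit firstExitWindow_oneStepWindowL_proof hF

end Summit.QuantumFields.YangMills.Theorems.LargeFieldMassRefinementTailOfFirstExit
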